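import Mathlib
import Literature.Analysis.FluidPDE.Vorticity
import Literature.Analysis.FluidPDE.WholeSpaceIBP
import Literature.Analysis.FluidPDE.MildSolutionProofs
import Literature.Analysis.FluidPDE.VorticityCalculus
import Literature.Analysis.FluidPDE.HelicityDensityWeightedBalance
import Summits.NavierStokesRegularity.NavierStokesRegularity.Theorems.PowerGaugeEulerLiouville.Negative.IntegrableVorticityNotRelaxing
/-!
# Crux `EulerZoomLiouville.PowerGaugeEulerLiouville` (stmt-NavierStokesRegularity-19832) —
# HELICITY IS CONSERVED UNDER INTEGRABILITY BUDGETS, AND NO CLASSICAL EULER FLOW WITH NON-ZERO HELICITY IS RELAXING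
Negative-lane structure record (prover hand leafhand-ns-eulerzoomliouville-10 g0; `--supports` stmt-19832; def-free).
The refutation doors of the crux X_E on the classical side (`…Negative.ForwardRelaxingClassicalFlow`, door (F): a global
classical Euler flow on `(0,∞) × ℝ³` with bounded energy and FINITE space–time enstrophy `∫∫_{(0,∞)×ℝ³}|∇v|²_F`;
`…Negative.BudgetedClassicalAncientFlow`, door (A): its ancient twin on `(−∞,0)`) were narrowed by hands 8/9 to flows with
vorticity of unbounded volume (`…RelaxingFlowFatVorticity`, `…FatVorticityFiniteVolume`) which is NOT integrable on any slice
(`…IntegrableVorticityNotRelaxing`, `…AncientIntegrableVorticitySlice`).  This file adds the CHIRALITY constraint, by the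
one global Casimir of 3-D Euler not yet spent on the doors:

* `helicity_eq_of_classical_euler` — **conservation of helicity WITHOUT pointwise decay**: for a classical Euler flow on an
  OPEN time set `S ⊇ [s,t]` whose slices on `[s,t]` have `⟪u, curl u⟫ ∈ L¹` and the two helicity-FLUX budgets
  `∫‖u‖²‖curl u‖ ≤ M`, `∫|p|‖curl u‖ ≤ M`, one has `H(u(t)) = H(u(s))` — the windowed helicity law of the tree
  (`IsClassicalNSSolutionOn.hasDerivAt_integral_mul_helicityDensity`, Majda–Bertozzi Prop. 1.12 (iv) tested against
  `χ_R`) has flux `O(M/R)`, and `R → ∞`.  The tree's `euler_helicity_conservation_holds` needs Schwartz decay of `u`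
  (`HasUniformRapidDecayOn`), which forces `curl u ∈ L¹` — vacuous on the residual of hand 9; the budgets here allow
  `|curl u| ~ |x|^{−α}`, `5/2 < α < 3` (`u ~ |x|^{1−α} ∈ L²`, `‖u‖²‖ω‖ ~ |x|^{2−3α} ∈ L¹`).
* `ofReal_helicity_sq_le` — **the helicity floor** `H(w)² ≤ (∫‖w‖²) · 2∫|∇w|²_F` (Cauchy–Schwarz and `|curl w|² ≤ 2|∇w|²_F`),
  i.e. `∫|∇w|²_F ≥ H²/(2∫|w|²)` on every slice: energy `E` and helicity `H ≠ 0` pin the enstrophy from below.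
* `setLIntegral_enstrophy_eq_top_of_helicity` — a `C¹` space–time field on `S × ℝ³`, `S` an open time set of infinite
  measure, with slice energies `≤ E < ∞` and slice helicities `|H(v(s))| ≥ η > 0` has `∫∫_{S×ℝ³}|∇v|²_F = ∞`;
  `setLIntegral_enstrophy_eq_top_of_classical_euler_of_helicity_ne_zero` — for a classical Euler flow on such an
  (order-connected) `S` with the budgets, `H ≠ 0` at ONE time already gives `∫∫_{S×ℝ³}|∇u|²_F = ∞`.
* `no_relaxing_classicalEuler_of_helicity_ne_zero` — **door (F) is chirality-free**: a classical Euler flow on `(0,∞) × ℝ³`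
  with the door's energy bound, the helicity budgets locally uniformly in time, and `H(v(s₀)) ≠ 0` at ONE time violates
  every space–time enstrophy budget `∫∫|∇v|²_F ≤ M`; `no_budgetedAncient_classicalEuler_of_helicity_ne_zero` — the door (A)
  twin on `(−∞,0)` (same proof on the time set `(−∞,0)`; `helicity_neg` records `H(−w) = H(w)` for the time-reversal
  dictionary `v(s) = −u(−s)` of `…ForwardRelaxingClassicalFlow`).

So every classical candidate for doors (A)/(F) has ZERO HELICITY ON EVERY SLICE (besides non-integrable, fat vorticity); honest
label: swirl-free axisymmetric candidates (vortex rings) have zero helicity anyway — the constraint bites on chiral candidates only.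
WHAT THIS IS NOT: not a refutation or proof of the crux, of a stub, or of the route; not a claim about Navier–Stokes; nothing is
constructed.  [folklore; cite: MajdaBertozziCUP2002 §1.7 Prop. 1.12 (iv); Moffatt1969 §3; MoffattTsinober1992 §2] -/
noncomputable section
set_option linter.dupNamespace false
namespace Summit.NavierStokesRegularity.NavierStokesRegularity.Theorems.PowerGaugeEulerLiouville.Negative

open MeasureTheory Set Function Filter Topology Metric Literature.Analysis Literature.Analysis.FluidPDE
open scoped NNReal ENNReal RealInnerProductSpace Laplacian

/-! ## Part A — conservation of helicity under integrability budgets -/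

/-- Pointwise bound on the windowed helicity flux against the cut-off `χ_R`:
`|⟪u,ω⟫ Dχ_R(u) | ≤ (C/R) ‖u‖²‖ω‖` and `|(p − ½|u|²) Dχ_R(ω)| ≤ (C/R)(|p|‖ω‖ + ½‖u‖²‖ω‖)`. [folklore] -/
theorem norm_helicityFlux_le {C R : ℝ} (hC : ∀ x : EuclideanSpace ℝ (Fin 3), ‖fderiv ℝ (cutoff R) x‖ ≤ C / R)
    (v b : EuclideanSpace ℝ (Fin 3)) (q : ℝ) (x : EuclideanSpace ℝ (Fin 3)) :
    ‖⟪v, b⟫ * fderiv ℝ (cutoff R) x v + (q - (1 / 2) * ‖v‖ ^ 2) * fderiv ℝ (cutoff R) x b‖ ≤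
      C / R * (‖v‖ ^ 2 * ‖b‖ + (|q| * ‖b‖ + (1 / 2) * (‖v‖ ^ 2 * ‖b‖))) := by
  have h1 : ‖fderiv ℝ (cutoff R) x v‖ ≤ C / R * ‖v‖ :=
    ((fderiv ℝ (cutoff R) x).le_opNorm v).trans (mul_le_mul_of_nonneg_right (hC x) (norm_nonneg _))
  have h2 : ‖fderiv ℝ (cutoff R) x b‖ ≤ C / R * ‖b‖ :=
    ((fderiv ℝ (cutoff R) x).le_opNorm b).trans (mul_le_mul_of_nonneg_right (hC x) (norm_nonneg _))
  have hin : ‖⟪v, b⟫‖ ≤ ‖v‖ * ‖b‖ := by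
    rw [Real.norm_eq_abs]; exact abs_real_inner_le_norm v b
  have hq : ‖q - (1 / 2) * ‖v‖ ^ 2‖ ≤ |q| + (1 / 2) * ‖v‖ ^ 2 := by
    rw [Real.norm_eq_abs]
    have h0 : 0 ≤ (1 / 2) * ‖v‖ ^ 2 := by positivity
    have h3 : q ≤ |q| := le_abs_self q
    have h4 : -|q| ≤ q := neg_abs_le q
    exact abs_sub_le_iff.2 ⟨by linarith, by linarith⟩
  calc ‖⟪v, b⟫ * fderiv ℝ (cutoff R) x v + (q - (1 / 2) * ‖v‖ ^ 2) * fderiv ℝ (cutoff R) x b‖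
      ≤ ‖⟪v, b⟫ * fderiv ℝ (cutoff R) x v‖ + ‖(q - (1 / 2) * ‖v‖ ^ 2) * fderiv ℝ (cutoff R) x b‖ := norm_add_le _ _
    _ = ‖⟪v, b⟫‖ * ‖fderiv ℝ (cutoff R) x v‖ + ‖q - (1 / 2) * ‖v‖ ^ 2‖ * ‖fderiv ℝ (cutoff R) x b‖ := by
        rw [norm_mul, norm_mul]
    _ ≤ (‖v‖ * ‖b‖) * (C / R * ‖v‖) + (|q| + (1 / 2) * ‖v‖ ^ 2) * (C / R * ‖b‖) := by
        gcongr
    _ = C / R * (‖v‖ ^ 2 * ‖b‖ + (|q| * ‖b‖ + (1 / 2) * (‖v‖ ^ 2 * ‖b‖))) := by ring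

/-- **Conservation of helicity for classical Euler flows under integrability budgets (no pointwise decay).**  Let `(u,p)`
be a classical Euler flow on an open time set `S` and `[s,t] ⊆ S`.  If on `[s,t]` the helicity density `⟪u, curl u⟫` is
integrable and the helicity fluxes are budgeted, `∫‖u(τ)‖²‖curl u(τ)‖ ≤ M` and `∫|p(τ)|‖curl u(τ)‖ ≤ M`, then
`H(u(t)) = H(u(s))`: the windowed law `d/dτ ∫χ_R⟪u,ω⟫ = ∫⟪u,ω⟫Dχ_R(u) + ∫(p − ½|u|²)Dχ_R(ω)` has right-hand side
`≤ (C/R)(5M/2)`, so `|∫χ_R⟪u(t),ω(t)⟫ − ∫χ_R⟪u(s),ω(s)⟫| ≤ (C/R)(5M/2)(t−s) → 0`, while the left converges to `H(u(t)) − H(u(s))`.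
[folklore; cite: MajdaBertozziCUP2002 §1.7 Prop. 1.12 (iv), proof pp. 24–26] -/
theorem helicity_eq_of_classical_euler
    {S : Set ℝ} (hS : IsOpen S)
    {u : ℝ → EuclideanSpace ℝ (Fin 3) → EuclideanSpace ℝ (Fin 3)} {p : ℝ → EuclideanSpace ℝ (Fin 3) → ℝ}
    (hsol : IsClassicalEulerSolutionOn S 0 u p) {s t : ℝ} (hst : s ≤ t) (hI : Icc s t ⊆ S) {M : ℝ}
    (hH : ∀ τ ∈ Icc s t, Integrable (fun y => ⟪u τ y, curl (u τ) y⟫))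
    (hF : ∀ τ ∈ Icc s t, Integrable (fun y => ‖u τ y‖ ^ 2 * ‖curl (u τ) y‖) ∧
      ∫ y, ‖u τ y‖ ^ 2 * ‖curl (u τ) y‖ ≤ M)
    (hP : ∀ τ ∈ Icc s t, Integrable (fun y => |p τ y| * ‖curl (u τ) y‖) ∧
      ∫ y, |p τ y| * ‖curl (u τ) y‖ ≤ M) :
    helicity (u t) = helicity (u s) := by
  obtain ⟨C, hC0, hC⟩ := exists_norm_fderiv_cutoff_le (E := EuclideanSpace ℝ (Fin 3))
  have hM0 : 0 ≤ M :=
    (integral_nonneg fun y => mul_nonneg (sq_nonneg _) (norm_nonneg _)).trans (hF t ⟨hst, le_rfl⟩).2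
  -- the windowed helicities `g_n(τ) = ∫ χ_{n+1} ⟪u(τ), curl u(τ)⟫` and their increments
  have hloc : ∀ n : ℕ, ‖(∫ x, cutoff ((n : ℝ) + 1) x * ⟪u t x, curl (u t) x⟫) -
      (∫ x, cutoff ((n : ℝ) + 1) x * ⟪u s x, curl (u s) x⟫)‖ ≤
        C / ((n : ℝ) + 1) * (M + (M + (1 / 2) * M)) * ‖t - s‖ := by
    intro n
    have hR : (0 : ℝ) < (n : ℝ) + 1 := by positivity
    -- derivative of `g_n` within `[s,t]` at every `τ ∈ [s,t]`
    have hderiv : ∀ τ ∈ Icc s t, HasDerivWithinAt (fun σ => ∫ x, cutoff ((n : ℝ) + 1) x * ⟪u σ x, curl (u σ) x⟫)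
        ((∫ x, ⟪u τ x, curl (u τ) x⟫ * fderiv ℝ (cutoff ((n : ℝ) + 1)) x (u τ x)) +
          (∫ x, (p τ x - (1 / 2) * ‖u τ x‖ ^ 2) * fderiv ℝ (cutoff ((n : ℝ) + 1)) x (curl (u τ) x)) +
          0 * ∫ x, cutoff ((n : ℝ) + 1) x * (⟪Δ (u τ) x, curl (u τ) x⟫ + ⟪u τ x, Δ (curl (u τ)) x⟫))
        (Icc s t) τ := fun τ hτ =>
      (hsol.hasDerivAt_integral_mul_helicityDensity hS (hI hτ) (contDiff_cutoff _)
        (hasCompactSupport_cutoff hR)).hasDerivWithinAt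
    -- bound on the derivative
    have hbound : ∀ τ ∈ Icc s t,
        ‖(∫ x, ⟪u τ x, curl (u τ) x⟫ * fderiv ℝ (cutoff ((n : ℝ) + 1)) x (u τ x)) +
          (∫ x, (p τ x - (1 / 2) * ‖u τ x‖ ^ 2) * fderiv ℝ (cutoff ((n : ℝ) + 1)) x (curl (u τ) x)) +
          0 * ∫ x, cutoff ((n : ℝ) + 1) x * (⟪Δ (u τ) x, curl (u τ) x⟫ + ⟪u τ x, Δ (curl (u τ)) x⟫)‖ ≤
        C / ((n : ℝ) + 1) * (M + (M + (1 / 2) * M)) := by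
      intro τ hτ
      obtain ⟨hFi, hFb⟩ := hF τ hτ
      obtain ⟨hPi, hPb⟩ := hP τ hτ
      rw [zero_mul, add_zero]
      -- measurability of the two flux integrands (continuous slices)
      have huc : Continuous (u τ) := (hsol.contDiff_velocity (hI hτ)).continuous
      have hωc : Continuous (curl (u τ)) :=
        continuous_curl ((hsol.contDiff_velocity (hI hτ)).of_le (by norm_cast))
      have hpc : Continuous (p τ) := (hsol.contDiff_pressure (hI hτ)).continuous
      have hχc : Continuous (fun x : EuclideanSpace ℝ (Fin 3) => fderiv ℝ (cutoff ((n : ℝ) + 1)) x) :=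
        ((contDiff_cutoff (E := EuclideanSpace ℝ (Fin 3)) (n := 1) ((n : ℝ) + 1)).continuous_fderiv one_ne_zero)
      have hm1 : AEStronglyMeasurable
          (fun x => ⟪u τ x, curl (u τ) x⟫ * fderiv ℝ (cutoff ((n : ℝ) + 1)) x (u τ x)) volume :=
        ((huc.inner hωc).mul (hχc.clm_apply huc)).aestronglyMeasurable
      have hm2 : AEStronglyMeasurable
          (fun x => (p τ x - (1 / 2) * ‖u τ x‖ ^ 2) * fderiv ℝ (cutoff ((n : ℝ) + 1)) x (curl (u τ) x)) volume :=
        ((hpc.sub (continuous_const.mul (huc.norm.pow 2))).mul (hχc.clm_apply hωc)).aestronglyMeasurable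
      -- the sum of the two fluxes, pointwise dominated by an integrable function
      have hdom : Integrable (fun x => C / ((n : ℝ) + 1) *
          (‖u τ x‖ ^ 2 * ‖curl (u τ) x‖ + (|p τ x| * ‖curl (u τ) x‖ + (1 / 2) * (‖u τ x‖ ^ 2 * ‖curl (u τ) x‖)))) :=
        (hFi.add (hPi.add (hFi.const_mul _))).const_mul _
      have hpt : ∀ x, ‖⟪u τ x, curl (u τ) x⟫ * fderiv ℝ (cutoff ((n : ℝ) + 1)) x (u τ x) +
          (p τ x - (1 / 2) * ‖u τ x‖ ^ 2) * fderiv ℝ (cutoff ((n : ℝ) + 1)) x (curl (u τ) x)‖ ≤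
          C / ((n : ℝ) + 1) *
            (‖u τ x‖ ^ 2 * ‖curl (u τ) x‖ + (|p τ x| * ‖curl (u τ) x‖ + (1 / 2) * (‖u τ x‖ ^ 2 * ‖curl (u τ) x‖))) :=
        fun x => norm_helicityFlux_le (hC _ hR) _ _ _ _
      have hsum : Integrable (fun x => ⟪u τ x, curl (u τ) x⟫ * fderiv ℝ (cutoff ((n : ℝ) + 1)) x (u τ x) +
          (p τ x - (1 / 2) * ‖u τ x‖ ^ 2) * fderiv ℝ (cutoff ((n : ℝ) + 1)) x (curl (u τ) x)) :=
        hdom.mono' (hm1.add hm2) (Eventually.of_forall hpt)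
      -- each flux is integrable (dominated by the same function)
      have hpt1 : ∀ x, ‖⟪u τ x, curl (u τ) x⟫ * fderiv ℝ (cutoff ((n : ℝ) + 1)) x (u τ x)‖ ≤
          C / ((n : ℝ) + 1) *
            (‖u τ x‖ ^ 2 * ‖curl (u τ) x‖ + (|p τ x| * ‖curl (u τ) x‖ + (1 / 2) * (‖u τ x‖ ^ 2 * ‖curl (u τ) x‖))) := by
        intro x
        have h := norm_helicityFlux_le (hC _ hR) (u τ x) (curl (u τ) x) (p τ x) x
        have h1 : ‖fderiv ℝ (cutoff ((n : ℝ) + 1)) x (u τ x)‖ ≤ C / ((n : ℝ) + 1) * ‖u τ x‖ :=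
          ((fderiv ℝ (cutoff ((n : ℝ) + 1)) x).le_opNorm _).trans
            (mul_le_mul_of_nonneg_right (hC _ hR x) (norm_nonneg _))
        calc ‖⟪u τ x, curl (u τ) x⟫ * fderiv ℝ (cutoff ((n : ℝ) + 1)) x (u τ x)‖
            = ‖⟪u τ x, curl (u τ) x⟫‖ * ‖fderiv ℝ (cutoff ((n : ℝ) + 1)) x (u τ x)‖ := norm_mul _ _
          _ ≤ (‖u τ x‖ * ‖curl (u τ) x‖) * (C / ((n : ℝ) + 1) * ‖u τ x‖) := by
              gcongr
              rw [Real.norm_eq_abs]; exact abs_real_inner_le_norm _ _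
          _ = C / ((n : ℝ) + 1) * (‖u τ x‖ ^ 2 * ‖curl (u τ) x‖) := by ring
          _ ≤ C / ((n : ℝ) + 1) *
            (‖u τ x‖ ^ 2 * ‖curl (u τ) x‖ + (|p τ x| * ‖curl (u τ) x‖ + (1 / 2) * (‖u τ x‖ ^ 2 * ‖curl (u τ) x‖))) := by
              gcongr
              exact le_add_of_nonneg_right (by positivity)
      have hint1 : Integrable (fun x => ⟪u τ x, curl (u τ) x⟫ * fderiv ℝ (cutoff ((n : ℝ) + 1)) x (u τ x)) :=
        hdom.mono' hm1 (Eventually.of_forall hpt1)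
      have hint2 : Integrable
          (fun x => (p τ x - (1 / 2) * ‖u τ x‖ ^ 2) * fderiv ℝ (cutoff ((n : ℝ) + 1)) x (curl (u τ) x)) := by
        have := hsum.sub hint1
        refine this.congr (Eventually.of_forall fun x => ?_)
        simp only [Pi.sub_apply]
        ring
      rw [← integral_add hint1 hint2]
      refine (norm_integral_le_of_norm_le hdom (Eventually.of_forall hpt)).trans ?_
      have hg2 : Integrable (fun x => (1 / 2) * (‖u τ x‖ ^ 2 * ‖curl (u τ) x‖)) := hFi.const_mul _
      have hg : Integrable (fun x => |p τ x| * ‖curl (u τ) x‖ + (1 / 2) * (‖u τ x‖ ^ 2 * ‖curl (u τ) x‖)) :=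
        hPi.add hg2
      rw [integral_const_mul, integral_add hFi hg, integral_add hPi hg2, integral_const_mul]
      gcongr
    exact (convex_Icc s t).norm_image_sub_le_of_norm_hasDerivWithin_le hderiv hbound
      (left_mem_Icc.2 hst) (right_mem_Icc.2 hst)
  -- the limits `n → ∞`
  have hlim : Tendsto (fun n : ℕ => (∫ x, cutoff ((n : ℝ) + 1) x * ⟪u t x, curl (u t) x⟫) -
      (∫ x, cutoff ((n : ℝ) + 1) x * ⟪u s x, curl (u s) x⟫)) atTop
      (𝓝 ((∫ x, ⟪u t x, curl (u t) x⟫) - ∫ x, ⟪u s x, curl (u s) x⟫)) :=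
    (tendsto_integral_cutoff_mul (hH t ⟨hst, le_rfl⟩)).sub (tendsto_integral_cutoff_mul (hH s ⟨le_rfl, hst⟩))
  have hb : Tendsto (fun n : ℕ => C / ((n : ℝ) + 1) * (M + (M + (1 / 2) * M)) * ‖t - s‖) atTop (𝓝 0) := by
    have h1 : Tendsto (fun n : ℕ => C / ((n : ℝ) + 1)) atTop (𝓝 0) :=
      tendsto_const_nhds.div_atTop (tendsto_natCast_atTop_atTop.atTop_add tendsto_const_nhds)
    simpa using (h1.mul_const (M + (M + (1 / 2) * M))).mul_const ‖t - s‖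
  have hzero : Tendsto (fun n : ℕ => (∫ x, cutoff ((n : ℝ) + 1) x * ⟪u t x, curl (u t) x⟫) -
      (∫ x, cutoff ((n : ℝ) + 1) x * ⟪u s x, curl (u s) x⟫)) atTop (𝓝 0) :=
    squeeze_zero_norm hloc hb
  have heq := tendsto_nhds_unique hlim hzero
  show (∫ x, ⟪u t x, curl (u t) x⟫) = ∫ x, ⟪u s x, curl (u s) x⟫
  linarith

/-! ## Part B — the helicity floor on the enstrophy of a slice -/

/-- **The helicity floor.**  For a `C¹` field `w` on `ℝ³`: `H(w)² ≤ (∫‖w‖²) · (2 ∫|∇w|²_F)` in `ℝ≥0∞` (if `⟪w, curl w⟫` is not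
integrable the left side is `0`; otherwise Cauchy–Schwarz and `‖curl w‖² ≤ 2|∇w|²_F`).  Equivalently
`∫|∇w|²_F ≥ H(w)²/(2∫‖w‖²)`: energy and a non-zero helicity pin the enstrophy from below. [folklore; cite: Moffatt1969 §3] -/
theorem ofReal_helicity_sq_le {w : EuclideanSpace ℝ (Fin 3) → EuclideanSpace ℝ (Fin 3)} (hw : ContDiff ℝ 1 w) :
    ENNReal.ofReal (helicity w ^ 2) ≤
      (∫⁻ x, ‖w x‖ₑ ^ 2) * (2 * ∫⁻ x, ENNReal.ofReal (frobeniusNormSq (fderiv ℝ w x))) := by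
  set h : ℝ := helicity w with hh
  have hwm : Measurable w := hw.continuous.measurable
  have hcm : Measurable (curl w) := (continuous_curl hw).measurable
  -- `‖h‖ₑ ≤ ∫⁻ ‖w‖ₑ ‖curl w‖ₑ`
  have hpt : ∀ x, ‖⟪w x, curl w x⟫‖ₑ ≤ ‖w x‖ₑ * ‖curl w x‖ₑ := by
    intro x
    rw [Real.enorm_eq_ofReal_abs, ← ofReal_norm, ← ofReal_norm, ← ENNReal.ofReal_mul (norm_nonneg _)]
    exact ENNReal.ofReal_le_ofReal (abs_real_inner_le_norm _ _)
  have h1 : ‖h‖ₑ ≤ ∫⁻ x, ‖w x‖ₑ * ‖curl w x‖ₑ :=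
    calc ‖h‖ₑ ≤ ∫⁻ x, ‖⟪w x, curl w x⟫‖ₑ := enorm_integral_le_lintegral_enorm _
      _ ≤ ∫⁻ x, ‖w x‖ₑ * ‖curl w x‖ₑ := lintegral_mono hpt
  -- Hölder `2, 2`
  have hfm : AEMeasurable (fun x => ‖w x‖ₑ) volume := hwm.enorm.aemeasurable
  have hgm : AEMeasurable (fun x => ‖curl w x‖ₑ) volume := hcm.enorm.aemeasurable
  have hcs := ENNReal.lintegral_mul_le_Lp_mul_Lq volume Real.HolderConjugate.two_two hfm hgm
  simp only [Pi.mul_apply, ENNReal.rpow_two] at hcs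
  have h2 : ‖h‖ₑ ^ 2 ≤ (∫⁻ x, ‖w x‖ₑ ^ 2) * ∫⁻ x, ‖curl w x‖ₑ ^ 2 := by
    calc ‖h‖ₑ ^ 2 ≤ (∫⁻ x, ‖w x‖ₑ * ‖curl w x‖ₑ) ^ 2 := by gcongr
      _ ≤ ((∫⁻ x, ‖w x‖ₑ ^ 2) ^ (1 / 2 : ℝ) * (∫⁻ x, ‖curl w x‖ₑ ^ 2) ^ (1 / 2 : ℝ)) ^ 2 := by gcongr
      _ = (∫⁻ x, ‖w x‖ₑ ^ 2) * ∫⁻ x, ‖curl w x‖ₑ ^ 2 := by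
          rw [← ENNReal.mul_rpow_of_nonneg _ _ (by norm_num : (0 : ℝ) ≤ 1 / 2), ← ENNReal.rpow_two,
            ← ENNReal.rpow_mul]
          norm_num
  have hlhs : ENNReal.ofReal (h ^ 2) = ‖h‖ₑ ^ 2 := by
    rw [Real.enorm_eq_ofReal_abs, ← ENNReal.ofReal_pow (abs_nonneg _), sq_abs]
  rw [hlhs]
  exact h2.trans (mul_le_mul' le_rfl (lintegral_enorm_curl_sq_le_two_mul w))

/-- The floor in quotient form: if `∫‖w‖² ≤ E` (`E : ℝ≥0`) then `ofReal (H(w)²) / (2E) ≤ ∫|∇w|²_F`. [folklore] -/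
theorem helicity_floor_le_enstrophy {w : EuclideanSpace ℝ (Fin 3) → EuclideanSpace ℝ (Fin 3)} (hw : ContDiff ℝ 1 w)
    {E : ℝ≥0} (hE : ∫⁻ x, ‖w x‖ₑ ^ 2 ≤ (E : ℝ≥0∞)) :
    ENNReal.ofReal (helicity w ^ 2) / (2 * (E : ℝ≥0∞)) ≤ ∫⁻ x, ENNReal.ofReal (frobeniusNormSq (fderiv ℝ w x)) := by
  have h := ofReal_helicity_sq_le hw
  have h' : ENNReal.ofReal (helicity w ^ 2) ≤
      (2 * (E : ℝ≥0∞)) * ∫⁻ x, ENNReal.ofReal (frobeniusNormSq (fderiv ℝ w x)) :=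
    calc ENNReal.ofReal (helicity w ^ 2)
        ≤ (∫⁻ x, ‖w x‖ₑ ^ 2) * (2 * ∫⁻ x, ENNReal.ofReal (frobeniusNormSq (fderiv ℝ w x))) := h
      _ ≤ (E : ℝ≥0∞) * (2 * ∫⁻ x, ENNReal.ofReal (frobeniusNormSq (fderiv ℝ w x))) := mul_le_mul' hE le_rfl
      _ = (2 * (E : ℝ≥0∞)) * ∫⁻ x, ENNReal.ofReal (frobeniusNormSq (fderiv ℝ w x)) := by ring
  exact ENNReal.div_le_of_le_mul' h'

/-- Helicity is even under `w ↦ −w`: `H(−w) = H(w)` (`curl (−w) = −curl w`). [folklore] -/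
theorem helicity_neg (w : EuclideanSpace ℝ (Fin 3) → EuclideanSpace ℝ (Fin 3)) :
    helicity (fun x => -w x) = helicity w := by
  show (∫ x, ⟪-w x, curl (fun y => -w y) x⟫) = ∫ x, ⟪w x, curl w x⟫
  refine integral_congr_ae (Eventually.of_forall fun x => ?_)
  simp only [curl_neg, inner_neg_neg]

/-! ## Part C — no classical Euler flow with non-zero helicity is relaxing -/

/-- **A uniform slice floor on an infinite time set makes the space–time enstrophy infinite** (Tonelli; the open-time-set
form of `…IntegrableVorticityNotRelaxing.setLIntegral_enstrophy_eq_top_of_sliceFloor`): for `v` jointly `C¹` on `S × ℝ³`,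
`S` open of infinite measure, and `φ₀ ≤ ∫|∇v(s)|²_F` for every `s ∈ S`, `φ₀ ≠ 0`, one has `∫∫_{S×ℝ³}|∇v|²_F = ∞`. [folklore] -/
theorem setLIntegral_enstrophy_eq_top_of_sliceFloor_of_isOpen {S : Set ℝ} (hS : IsOpen S) (hSvol : volume S = ⊤)
    {v : ℝ → EuclideanSpace ℝ (Fin 3) → EuclideanSpace ℝ (Fin 3)}
    (hv : ContDiffOn ℝ 1 (uncurry v) (S ×ˢ (univ : Set (EuclideanSpace ℝ (Fin 3)))))
    {φ₀ : ℝ≥0∞} (hφ₀ : φ₀ ≠ 0)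
    (hslice : ∀ s ∈ S, φ₀ ≤ ∫⁻ x, ENNReal.ofReal (frobeniusNormSq (fderiv ℝ (v s) x))) :
    ∫⁻ z in S ×ˢ (univ : Set (EuclideanSpace ℝ (Fin 3))),
      ENNReal.ofReal (frobeniusNormSq (fderiv ℝ (v z.1) z.2)) = ⊤ := by
  have hslice_cont : ContinuousOn (fun z : ℝ × EuclideanSpace ℝ (Fin 3) => fderiv ℝ (v z.1) z.2)
      (S ×ˢ (univ : Set (EuclideanSpace ℝ (Fin 3)))) :=
    continuousOn_fderiv_slice_of_contDiffOn hv hS.uniqueDiffOn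
  have hFcont : ContinuousOn
      (fun z : ℝ × EuclideanSpace ℝ (Fin 3) => ENNReal.ofReal (frobeniusNormSq (fderiv ℝ (v z.1) z.2)))
      (S ×ˢ (univ : Set (EuclideanSpace ℝ (Fin 3)))) :=
    ENNReal.continuous_ofReal.comp_continuousOn
      (LerayHopfProofs.continuous_frobeniusNormSq.comp_continuousOn hslice_cont)
  have hmeas : MeasurableSet (S ×ˢ (univ : Set (EuclideanSpace ℝ (Fin 3)))) :=
    hS.measurableSet.prod MeasurableSet.univ
  have hF : AEMeasurable
      (fun z : ℝ × EuclideanSpace ℝ (Fin 3) => ENNReal.ofReal (frobeniusNormSq (fderiv ℝ (v z.1) z.2)))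
      (((volume : Measure ℝ).prod (volume : Measure (EuclideanSpace ℝ (Fin 3)))).restrict
        (S ×ˢ (univ : Set (EuclideanSpace ℝ (Fin 3))))) := by
    rw [← Measure.volume_eq_prod]
    exact hFcont.aemeasurable hmeas
  rw [Measure.volume_eq_prod, setLIntegral_prod _ hF]
  simp only [Measure.restrict_univ]
  refine eq_top_iff.2 ?_
  calc (⊤ : ℝ≥0∞) = φ₀ * volume S := by rw [hSvol, ENNReal.mul_top hφ₀]
    _ = ∫⁻ _ in S, φ₀ := (setLIntegral_const _ _).symm
    _ ≤ ∫⁻ s in S, ∫⁻ x, ENNReal.ofReal (frobeniusNormSq (fderiv ℝ (v s) x)) :=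
        setLIntegral_mono' hS.measurableSet fun s hs => hslice s hs

/-- **A helicity floor makes the space–time enstrophy infinite.**  For `v` jointly `C¹` on `S × ℝ³` (`S` open of infinite
measure) with slice energies `∫‖v(s)‖² ≤ E` and slice helicities `η ≤ |H(v(s))|`, `η > 0`, for all `s ∈ S`:
`∫∫_{S×ℝ³}|∇v|²_F = ∞` (floor `η²/(2E)` on every slice, then Tonelli). [folklore] -/
theorem setLIntegral_enstrophy_eq_top_of_helicity {S : Set ℝ} (hS : IsOpen S) (hSvol : volume S = ⊤)
    {v : ℝ → EuclideanSpace ℝ (Fin 3) → EuclideanSpace ℝ (Fin 3)}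
    (hv : ContDiffOn ℝ 1 (uncurry v) (S ×ˢ (univ : Set (EuclideanSpace ℝ (Fin 3)))))
    {E : ℝ≥0} (hE : ∀ s ∈ S, ∫⁻ x, ‖v s x‖ₑ ^ 2 ≤ (E : ℝ≥0∞))
    {η : ℝ} (hη : 0 < η) (hH : ∀ s ∈ S, η ≤ |helicity (v s)|) :
    ∫⁻ z in S ×ˢ (univ : Set (EuclideanSpace ℝ (Fin 3))),
      ENNReal.ofReal (frobeniusNormSq (fderiv ℝ (v z.1) z.2)) = ⊤ := by
  set φ₀ : ℝ≥0∞ := ENNReal.ofReal (η ^ 2) / (2 * (E : ℝ≥0∞)) with hφ₀def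
  have hφ₀ : φ₀ ≠ 0 :=
    (ENNReal.div_pos_iff.2 ⟨(ENNReal.ofReal_pos.2 (by positivity)).ne',
      ENNReal.mul_ne_top ENNReal.ofNat_ne_top ENNReal.coe_ne_top⟩).ne'
  have hslice : ∀ s ∈ S, φ₀ ≤ ∫⁻ x, ENNReal.ofReal (frobeniusNormSq (fderiv ℝ (v s) x)) := by
    intro s hs
    have hC1 : ContDiff ℝ 1 (v s) := by
      have h := hv.comp_contDiff (contDiff_const.prodMk contDiff_id) (fun x => ⟨hs, mem_univ x⟩)
      exact h
    have hsq : ENNReal.ofReal (η ^ 2) ≤ ENNReal.ofReal (helicity (v s) ^ 2) := by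
      refine ENNReal.ofReal_le_ofReal ?_
      have := hH s hs
      rw [← sq_abs (helicity (v s))]
      exact pow_le_pow_left₀ hη.le this 2
    calc φ₀ = ENNReal.ofReal (η ^ 2) / (2 * (E : ℝ≥0∞)) := hφ₀def
      _ ≤ ENNReal.ofReal (helicity (v s) ^ 2) / (2 * (E : ℝ≥0∞)) := ENNReal.div_le_div_right hsq _
      _ ≤ ∫⁻ x, ENNReal.ofReal (frobeniusNormSq (fderiv ℝ (v s) x)) := helicity_floor_le_enstrophy hC1 (hE s hs)
  exact setLIntegral_enstrophy_eq_top_of_sliceFloor_of_isOpen hS hSvol hv hφ₀ hslice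

/-- **No classical Euler flow with non-zero helicity has finite space–time enstrophy on an infinite time set.**  Let `(u,p)`
be a classical Euler flow on an open order-connected time set `S` of infinite measure (e.g. `(0,∞)` or `(−∞,0)`), with slice
energies `∫‖u(τ)‖² ≤ E` on `S`, the helicity density integrable and the helicity fluxes budgeted locally uniformly on `S`
(`∫‖u‖²‖curl u‖, ∫|p|‖curl u‖ ≤ M'` on each `[a,b] ⊆ S`), and `H(u(s₀)) ≠ 0` at ONE time `s₀ ∈ S`.  Then the helicity is
the constant `H(u(s₀))` on `S` (`helicity_eq_of_classical_euler`), every slice has enstrophy `≥ H²/(2E)`, and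
`∫∫_{S×ℝ³}|∇u|²_F = ∞`. [folklore] -/
theorem setLIntegral_enstrophy_eq_top_of_classical_euler_of_helicity_ne_zero
    {S : Set ℝ} (hS : IsOpen S) (hSo : S.OrdConnected) (hSvol : volume S = ⊤)
    {u : ℝ → EuclideanSpace ℝ (Fin 3) → EuclideanSpace ℝ (Fin 3)} {p : ℝ → EuclideanSpace ℝ (Fin 3) → ℝ}
    (hsol : IsClassicalEulerSolutionOn S 0 u p)
    {E : ℝ≥0} (hE : ∀ τ ∈ S, ∫⁻ x, ‖u τ x‖ₑ ^ 2 ≤ (E : ℝ≥0∞))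
    (hunif : ∀ a ∈ S, ∀ b ∈ S, a ≤ b → ∃ M' : ℝ, ∀ τ ∈ Icc a b,
      Integrable (fun y => ⟪u τ y, curl (u τ) y⟫) ∧
      (Integrable (fun y => ‖u τ y‖ ^ 2 * ‖curl (u τ) y‖) ∧ ∫ y, ‖u τ y‖ ^ 2 * ‖curl (u τ) y‖ ≤ M') ∧
      (Integrable (fun y => |p τ y| * ‖curl (u τ) y‖) ∧ ∫ y, |p τ y| * ‖curl (u τ) y‖ ≤ M'))
    {s₀ : ℝ} (hs₀ : s₀ ∈ S) (hne : helicity (u s₀) ≠ 0) :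
    ∫⁻ z in S ×ˢ (univ : Set (EuclideanSpace ℝ (Fin 3))),
      ENNReal.ofReal (frobeniusNormSq (fderiv ℝ (u z.1) z.2)) = ⊤ := by
  -- helicity is constant on `S`
  have hcons : ∀ τ ∈ S, helicity (u τ) = helicity (u s₀) := by
    intro τ hτ
    rcases le_total τ s₀ with hle | hle
    · obtain ⟨M', hM'⟩ := hunif τ hτ s₀ hs₀ hle
      exact (helicity_eq_of_classical_euler hS hsol hle (hSo.out hτ hs₀) (fun σ hσ => (hM' σ hσ).1)
        (fun σ hσ => (hM' σ hσ).2.1) (fun σ hσ => (hM' σ hσ).2.2)).symm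
    · obtain ⟨M', hM'⟩ := hunif s₀ hs₀ τ hτ hle
      exact helicity_eq_of_classical_euler hS hsol hle (hSo.out hs₀ hτ) (fun σ hσ => (hM' σ hσ).1)
        (fun σ hσ => (hM' σ hσ).2.1) (fun σ hσ => (hM' σ hσ).2.2)
  have hv : ContDiffOn ℝ 1 (uncurry u) (S ×ˢ (univ : Set (EuclideanSpace ℝ (Fin 3)))) := by
    have hvInf : ContDiffOn ℝ (⊤ : ℕ∞) (uncurry u) (S ×ˢ (univ : Set (EuclideanSpace ℝ (Fin 3)))) :=
      hsol.smooth_velocity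
    exact hvInf.of_le (by norm_cast)
  refine setLIntegral_enstrophy_eq_top_of_helicity hS hSvol hv hE (abs_pos.2 hne) fun τ hτ => ?_
  rw [hcons τ hτ]

/-- **DOOR (F) IS CHIRALITY-FREE: no relaxing classical Euler flow has non-zero helicity.**  In the vocabulary of
`…Negative.ForwardRelaxingClassicalFlow.powerGaugeEulerLiouville_false_of_forwardRelaxingClassicalFlow`: a classical Euler
flow `(v,q)` on `(0,∞) × ℝ³` with the door's energy bound `∫|v(s)|² ≤ M`, integrable helicity density and budgeted helicity
fluxes locally uniformly in time, and `H(v(s₀)) ≠ 0` at one time `s₀ > 0`, violates the door's space–time enstrophy budget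
`∫∫_{(0,∞)×ℝ³}|∇v|²_F ≤ M`.  So a relaxing flow refuting X_E through door (F) has `H ≡ 0`. [folklore] -/
theorem no_relaxing_classicalEuler_of_helicity_ne_zero
    {v : ℝ → EuclideanSpace ℝ (Fin 3) → EuclideanSpace ℝ (Fin 3)} {q : ℝ → EuclideanSpace ℝ (Fin 3) → ℝ} {M : ℝ≥0}
    (hsol : IsClassicalEulerSolutionOn (Ioi (0 : ℝ)) 0 v q)
    (hA : ∀ s : ℝ, 0 < s → ∫⁻ x, ‖v s x‖ₑ ^ 2 ≤ (M : ℝ≥0∞))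
    (hunif : ∀ a b : ℝ, 0 < a → a ≤ b → ∃ M' : ℝ, ∀ τ ∈ Icc a b,
      Integrable (fun y => ⟪v τ y, curl (v τ) y⟫) ∧
      (Integrable (fun y => ‖v τ y‖ ^ 2 * ‖curl (v τ) y‖) ∧ ∫ y, ‖v τ y‖ ^ 2 * ‖curl (v τ) y‖ ≤ M') ∧
      (Integrable (fun y => |q τ y| * ‖curl (v τ) y‖) ∧ ∫ y, |q τ y| * ‖curl (v τ) y‖ ≤ M'))
    {s₀ : ℝ} (hs₀ : 0 < s₀) (hne : helicity (v s₀) ≠ 0)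
    (hEns : ∫⁻ z in Ioi (0 : ℝ) ×ˢ (univ : Set (EuclideanSpace ℝ (Fin 3))),
      ENNReal.ofReal (frobeniusNormSq (fderiv ℝ (v z.1) z.2)) ≤ (M : ℝ≥0∞)) : False := by
  have hvol : volume (Ioi (0 : ℝ)) = ⊤ := Real.volume_Ioi
  have htop := setLIntegral_enstrophy_eq_top_of_classical_euler_of_helicity_ne_zero isOpen_Ioi ordConnected_Ioi hvol
    hsol (fun τ hτ => hA τ hτ) (fun a ha b _ hab => hunif a b ha hab) hs₀ hne
  rw [htop] at hEns
  exact ENNReal.coe_ne_top (top_le_iff.1 hEns)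

/-- **DOOR (A) IS CHIRALITY-FREE: no budgeted classical ancient Euler flow has non-zero helicity.**  In the vocabulary of
`…Negative.BudgetedClassicalAncientFlow.powerGaugeEulerLiouville_false_of_ancientBudgetedClassicalFlow`: a classical Euler
flow `(u,p)` on `(−∞,0) × ℝ³` with the door's energy bound `∫|u(t)|² ≤ M` for `t < 0`, integrable helicity density and
budgeted helicity fluxes locally uniformly in time, and `H(u(t₀)) ≠ 0` at one time `t₀ < 0`, violates the door's space–time
enstrophy budget `∫∫_{(−∞,0)×ℝ³}|∇u|²_F ≤ M`.  So an ancient flow refuting X_E through door (A) has `H ≡ 0` on every slice.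
[folklore] -/
theorem no_budgetedAncient_classicalEuler_of_helicity_ne_zero
    {u : ℝ → EuclideanSpace ℝ (Fin 3) → EuclideanSpace ℝ (Fin 3)} {p : ℝ → EuclideanSpace ℝ (Fin 3) → ℝ} {M : ℝ≥0}
    (hsol : IsClassicalEulerSolutionOn (Iio (0 : ℝ)) 0 u p)
    (hA : ∀ t : ℝ, t < 0 → ∫⁻ x, ‖u t x‖ₑ ^ 2 ≤ (M : ℝ≥0∞))
    (hunif : ∀ a b : ℝ, a ≤ b → b < 0 → ∃ M' : ℝ, ∀ τ ∈ Icc a b,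
      Integrable (fun y => ⟪u τ y, curl (u τ) y⟫) ∧
      (Integrable (fun y => ‖u τ y‖ ^ 2 * ‖curl (u τ) y‖) ∧ ∫ y, ‖u τ y‖ ^ 2 * ‖curl (u τ) y‖ ≤ M') ∧
      (Integrable (fun y => |p τ y| * ‖curl (u τ) y‖) ∧ ∫ y, |p τ y| * ‖curl (u τ) y‖ ≤ M'))
    {t₀ : ℝ} (ht₀ : t₀ < 0) (hne : helicity (u t₀) ≠ 0)
    (hEns : ∫⁻ z in Iio (0 : ℝ) ×ˢ (univ : Set (EuclideanSpace ℝ (Fin 3))),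
      ENNReal.ofReal (frobeniusNormSq (fderiv ℝ (u z.1) z.2)) ≤ (M : ℝ≥0∞)) : False := by
  have hvol : volume (Iio (0 : ℝ)) = ⊤ := Real.volume_Iio
  have htop := setLIntegral_enstrophy_eq_top_of_classical_euler_of_helicity_ne_zero isOpen_Iio ordConnected_Iio hvol
    hsol (fun τ hτ => hA τ hτ) (fun a _ b hb hab => hunif a b hab hb) ht₀ hne
  rw [htop] at hEns
  exact ENNReal.coe_ne_top (top_le_iff.1 hEns)

end Summit.NavierStokesRegularity.NavierStokesRegularity.Theorems.PowerGaugeEulerLiouville.Negative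
end
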